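/-
Copyright (c) 2026 the pub-hodgecm-mathlib formalisation cell (harness21).  Prover seat hodgecm-mathlib-K2E1-p02 (g4), Track B ∕ K2-LIT, h413 =
`stmt-HodgeConjecture-24833`, line `K2_E1_TraceFormulaBeta`; DEAL H ∕ brick (H1) of the dealer K2E1-plan (g2) 2026-09-04T02:12:50Z (campaign «RES-RANK-ONE»):
FILE B — THE ADMISSIBILITY ENTRANCE to the residual-compactness sockets 5Res ∕ 12R3.
-/
import Summits.HodgeConjecture.HodgeConjecture.Theorems.K2E1AdmissibleSmearFiniteRank       -- ★ p856765 (this seat, FILE A): `isCompactOperator_integratedOperator_of_isTranslationFinite`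
import Summits.HodgeConjecture.HodgeConjecture.Theorems.K2E1CompactOfDiracFamily             -- ★ p855671 (K2E1-p02 g2): `exists_nhds_one_forall_integral_norm_leftTranslate_sub_le`
import Summits.HodgeConjecture.HodgeConjecture.Theorems.K2E1CuspidalSpectrumUnitaryDefsR      -- ★ p855423: `residualSubspace`, `ResidualSpectrumCompact`, `cmResidualSubspaceR`, `CmResidualSpectrumCompactR`
import HarnessLib

/-!
# K2·E1 — `K2E1ResidualCompactOfAdmissible`: THE ADMISSIBILITY ENTRANCE — `R(f)` IS COMPACT ON EVERY `K`-ADMISSIBLE UNITARY REPRESENTATION, HENCE ON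
# `L²_res` AS SOON AS `L²_res` IS `K`-ADMISSIBLE (sockets `sig_K2E1ResidualCompactU2` :252 ∕ `sig_K2E1ResidualCompactU3R` :297 ⟸ (FD))

Track B ∕ K2-LIT, crux h413 = `stmt-HodgeConjecture-24833`, route of record `HCCMUnconditional`; cell `hodgecm-mathlib`, squad K2, ENGINE E1 (socket module
`K2_E1_TraceFormulaBetaSigs_GlobalIndex` ED. 12; live sockets 5Res ∕ 12R3 = ★ `CmResidualSpectrumCompactR L N μ`, `N = 2, 3`).  Prover seat
`hodgecm-mathlib-K2E1-p02` (g4); DEAL H, brick (H1) of the campaign «RES-RANK-ONE» (dealer K2E1-plan (g2) 2026-09-04T02:12:50Z on the memo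
`K2/K2E1-p02/g4/SPEC-residual-rank-one.md` 002a137abb1c63af: BOTH residual roads bottom out in rank-one Eisenstein theory WITH its finiteness clause; the
campaign's target is (FD) «`L²_res(U(Φ_N))` is `K_∞K_f`-ADMISSIBLE», and this file is the kernel-checked ENTRANCE (FD) ⇒ sockets).  THEOREMS ONLY (no `def`, no
`instance`, no notation, no named-fact hypothesis, no `sorry`); lane `--supports stmt-HodgeConjecture-24833 --as helper` (count-neutral).  Closes no socket.

WHAT.
* §1 `isCompactOperator_integratedOperator_of_admissible` — GENERIC: `G` a locally compact group, `η` a left-invariant measure finite on compacts, `π` a unitary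
  strongly continuous representation of `G` on a complex Hilbert space, `K` a compact Hausdorff group with a continuous `ιK : K →* G` such that `π ∘ ιK` is
  ADMISSIBLE on irreducible `K`-types (★ `hadm` currency of `HilbertRepAdmissibleDiscreteDecomposition`: every finite-dimensional irreducible `K`-stable `E` has
  finite-dimensional isotypic part ★ `Representation.homRangeSum`).  THEN `π(f) = ∫ f(g)π(g) dη` (★ `ContRepresentation.integratedOperator`) is a COMPACT operator
  for EVERY `f ∈ C_c(G, ℂ)`.  Proof: `‖π(g)π(f) − π(f)‖ ≤ ‖λ(g)f − f‖_{L¹(η)} → 0` as `g → 1` (★ `exists_nhds_one_forall_integral_norm_leftTranslate_sub_le`), so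
  for a normalised Urysohn bump `ψ₀` on `K` supported near `1`, `‖σ(ψ₀)π(f) − π(f)‖ ≤ ε` (`σ = π ∘ ιK`, `σ(ψ₀)` the smear over the Haar probability of `K`);
  Peter–Weyl (★ `dense_translationFiniteSubalgebra`) replaces `ψ₀` by a `K`-finite `ψ` at cost `‖ψ − ψ₀‖_∞ μ(K) ‖π(f)‖`; and `σ(ψ)π(f)` is compact because
  `σ(ψ)` has FINITE RANK (★ FILE A `isCompactOperator_integratedOperator_of_isTranslationFinite`); compact operators are norm-closed (Mathlib
  `isClosed_setOf_isCompactOperator`).  [HarishChandraTAMS1953 §9; BorelWallach2000 0 §2.3; DeitmarEchterhoff2014 Prop. 6.2.1, Lemma 6.2.2; Folland1995 Prop. 2.42.]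
* §2 `residualSpectrumCompact_of_admissible` — for ANY ★ adelic datum `𝒢` (`G(𝔸)` locally compact), automorphic `μ`, radicals `𝔓`: IF the residual spectrum
  `L²_res = L²_disc ⊓ (L²_cusp)ᗮ` (★ `residualSubspace`), as a unitary representation (★ `ClosedSubrep.toContRep`), is `K`-admissible for some compact Hausdorff
  `K →* G(𝔸)`, THEN ★ `ResidualSpectrumCompact 𝒢 μ 𝔓`.  §3 `cmResidualSpectrumCompactR_of_admissible` — its `U(Φ_N)` reading (all `N`): the sockets
  `sig_K2E1ResidualCompactU2` (`N = 2`) ∕ `sig_K2E1ResidualCompactU3R` (`N = 3`) ⟸ «`L²_res(U(Φ_N))` is `K`-admissible» — in print `K = K_∞ × K_f` and the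
  hypothesis is Langlands' finiteness: finitely many residual automorphic representations with a given `K_∞K_f`-type, each admissible of finite multiplicity
  [MoeglinWaldspurger1995 V.3.13; Rogawski1990 §13.9 p. 227; HarishChandra1968 Thm. 1].  SANITY at `N = 2` (dealer 02:12:50Z): `det : U(Φ₂) → U(1)`,
  `U(1)(L⁺)∖U(1)(𝔸)` compact, so every automorphic `χ∘det` spans a line of `L²_res` and only finitely many `χ` have a given restriction to the open
  finite-index subgroup `U(1)(L⁺)·det(K)`: ADMISSIBLE yes, while «`(L²_res)^{K_f}` finite-dimensional» is FALSE (all `∞`-types; ★ p08 (g2) record) — the entrance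
  asks exactly for the true statement.
HONEST LABEL: HC_CM is proved only modulo the 7 printed citations (2 remaining named inputs: hLiu418 = `stmt-HodgeConjecture-24832`, h413 =
`stmt-HodgeConjecture-24833`) until rung 0 closes; this file asserts no named fact and closes no socket (5Res ∕ 12R3 now read «`L²_res` admissible»).
References: [HarishChandraTAMS1953] Harish-Chandra, Trans. AMS 75 (1953), §9 Thm. 4 · [BorelWallach2000] A. Borel, N. Wallach, *Continuous Cohomology …*, 2nd
ed., 0 §2.3 · [DeitmarEchterhoff2014] A. Deitmar, S. Echterhoff, *Principles of Harmonic Analysis*, 2nd ed. (2014), Prop. 6.2.1, Lemma 6.2.2, §7.3 ·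
[Folland1995] G. B. Folland, *A Course in Abstract Harmonic Analysis* (1995), Prop. 2.42 · [MoeglinWaldspurger1995] C. Mœglin, J.-L. Waldspurger, *Spectral
Decomposition and Eisenstein Series* (1995), I.2.18, V.3.13 · [Rogawski1990] J. Rogawski, Ann. of Math. Stud. 123 (1990), §13.5 pp. 204–206, §13.9 p. 227 ·
[HarishChandra1968] Harish-Chandra, *Automorphic Forms on Semisimple Lie Groups*, LNM 62 (1968), Thm. 1.
-/

set_option autoImplicit false
-- the mandated namespace repeats the single-problem summit's segment (`HodgeConjecture.HodgeConjecture`)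
set_option linter.dupNamespace false

noncomputable section

open MeasureTheory Measure Filter Topology CompactlySupported Set
open scoped InnerProductSpace ENNReal
open Literature.NumberTheory.Automorphic
open Summit.HodgeConjecture.HodgeConjecture.Cruxes.H413.K2E1AdmissibleSmearFiniteRank
open Summit.HodgeConjecture.HodgeConjecture.Cruxes.H413.K2E1CompactOfDiracFamily (exists_nhds_one_forall_integral_norm_leftTranslate_sub_le)
open Summit.HodgeConjecture.HodgeConjecture.Cruxes.H413.K2E1CuspidalSpectrumUnitary

namespace Summit.HodgeConjecture.HodgeConjecture.Cruxes.H413.K2E1ResidualCompactOfAdmissible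

universe u

/-! ## §1 `π(f)` is compact on a `K`-admissible unitary representation -/

section Generic

variable {G : Type*} [Group G] [TopologicalSpace G] [IsTopologicalGroup G] [MeasurableSpace G] [BorelSpace G] [LocallyCompactSpace G]
  {H : Type*} [NormedAddCommGroup H] [InnerProductSpace ℂ H] [CompleteSpace H]
  {π : ContRepresentation ℂ G H}

omit [LocallyCompactSpace G] in
/-- **Left translation moves `π(f)` by at most the `L¹`-distance**: `π(g)(π(f)v) − π(f)v = ∫ (f(g⁻¹x) − f(x)) π(x)v dη(x)` for a left-invariant `η`, hence
`‖π(g)π(f)v − π(f)v‖ ≤ (∫ ‖f(g⁻¹x) − f(x)‖ dη) ‖v‖`. [cite: DeitmarEchterhoff2014, Prop. 6.2.1 and Lemma 6.2.2] [cite: Folland1995, Prop. 2.42] -/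
theorem norm_apply_integratedOperator_sub_le (hu : π.IsUnitary) (hc : π.IsStronglyContinuous) (η : Measure G) [IsFiniteMeasureOnCompacts η]
    [η.IsMulLeftInvariant] (f : C_c(G, ℂ)) (g : G) (v : H) :
    ‖π g (π.integratedOperator hu hc η f v) - π.integratedOperator hu hc η f v‖ ≤ (∫ x, ‖f (g⁻¹ * x) - f x‖ ∂η) * ‖v‖ := by
  -- the translated integrand
  have hcont : Continuous fun x : G => f (g⁻¹ * x) • π x v := (f.continuous.comp (continuous_const.mul continuous_id)).smul (hc v)
  have hsupp : HasCompactSupport fun x : G => f (g⁻¹ * x) • π x v := by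
    have h1 : HasCompactSupport fun x : G => f (g⁻¹ * x) := f.hasCompactSupport.comp_homeomorph (Homeomorph.mulLeft g⁻¹)
    exact h1.mono (Function.support_smul_subset_left _ _)
  have hint : Integrable (fun x : G => f (g⁻¹ * x) • π x v) η := hcont.integrable_of_hasCompactSupport hsupp
  -- `π(g) π(f) v = ∫ f(g⁻¹ x) π(x) v`
  have hshift : π g (π.integratedOperator hu hc η f v) = ∫ x, f (g⁻¹ * x) • π x v ∂η := by
    rw [ContRepresentation.integratedOperator_apply, ← (π g).integral_comp_comm (ContRepresentation.integrable_smul_apply hc η f v)]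
    have h1 : (fun x : G => π g (f x • π x v)) = fun x => (fun y : G => f (g⁻¹ * y) • π y v) (g * x) := by
      funext x
      simp only [inv_mul_cancel_left]
      rw [ContinuousLinearMap.map_smul, map_mul]
      rfl
    rw [h1, integral_mul_left_eq_self (fun y : G => f (g⁻¹ * y) • π y v) g]
  -- subtract and estimate
  have hsub : π g (π.integratedOperator hu hc η f v) - π.integratedOperator hu hc η f v = ∫ x, (f (g⁻¹ * x) - f x) • π x v ∂η := by
    rw [hshift, ContRepresentation.integratedOperator_apply, ← integral_sub hint (ContRepresentation.integrable_smul_apply hc η f v)]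
    refine integral_congr_ae (Eventually.of_forall fun x => ?_)
    simp only [sub_smul]
  rw [hsub]
  have hbound : Integrable (fun x : G => ‖f (g⁻¹ * x) - f x‖ * ‖v‖) η := by
    refine (hint.sub (ContRepresentation.integrable_smul_apply hc η f v)).norm.congr (Eventually.of_forall fun x => ?_)
    change ‖f (g⁻¹ * x) • π x v - f x • π x v‖ = ‖f (g⁻¹ * x) - f x‖ * ‖v‖
    rw [← sub_smul, norm_smul, hu.norm_map]
  calc ‖∫ x, (f (g⁻¹ * x) - f x) • π x v ∂η‖ ≤ ∫ x, ‖f (g⁻¹ * x) - f x‖ * ‖v‖ ∂η :=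
        norm_integral_le_of_norm_le hbound (Eventually.of_forall fun x => by rw [norm_smul, hu.norm_map])
    _ = (∫ x, ‖f (g⁻¹ * x) - f x‖ ∂η) * ‖v‖ := integral_mul_const _ _

/-- **`π(f)` IS COMPACT ON A `K`-ADMISSIBLE UNITARY REPRESENTATION.**  `G` locally compact, `η` left-invariant and finite on compacts, `π` unitary and strongly
continuous on a complex Hilbert space, `K` compact Hausdorff with a continuous `ιK : K →* G` such that `π ∘ ιK` is admissible on irreducible `K`-types (★ `hadm`
currency).  Then `π(f)` is a compact operator for every `f ∈ C_c(G, ℂ)` — approximate identity on `K` (Urysohn bump + `‖π(g)π(f) − π(f)‖ ≤ ‖λ(g)f − f‖₁`),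
Peter–Weyl density of `K`-finite functions (★ `dense_translationFiniteSubalgebra`), finite rank of `K`-finite smears (★ FILE A), norm-closedness of the compact
operators. [cite: HarishChandraTAMS1953, §9 Thm. 4] [cite: BorelWallach2000, 0 §2.3] [cite: DeitmarEchterhoff2014, Prop. 6.2.1 and Lemma 6.2.2] -/
theorem isCompactOperator_integratedOperator_of_admissible (hu : π.IsUnitary) (hc : π.IsStronglyContinuous)
    {K : Type*} [Group K] [TopologicalSpace K] [IsTopologicalGroup K] [CompactSpace K] [T2Space K] (ιK : K →* G) (hι : Continuous ιK)
    (hadm : ∀ (E : Submodule ℂ H) (hE : ∀ k, ∀ x ∈ E, (π.restrict ιK) k x ∈ E), FiniteDimensional ℂ E →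
      ((π.restrict ιK).subRep E hE).IsIrreducible →
      FiniteDimensional ℂ (Representation.homRangeSum (π.restrict ιK).toRepresentation ((π.restrict ιK).subRep E hE)))
    (η : Measure G) [IsFiniteMeasureOnCompacts η] [η.IsMulLeftInvariant] (f : C_c(G, ℂ)) :
    IsCompactOperator (π.integratedOperator hu hc η f) := by
  classical
  borelize K
  haveI : NormalSpace K := inferInstance
  set σ : ContRepresentation ℂ K H := π.restrict ιK with hσ_def
  have hσu : σ.IsUnitary := fun k => hu (ιK k)
  have hσc : σ.IsStronglyContinuous := fun v => (hc v).comp hι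
  set μ : Measure K := haarMeasure ⊤ with hμ_def
  set A : H →L[ℂ] H := π.integratedOperator hu hc η f with hA_def
  -- norm-closedness of the compact operators: it suffices to approximate `A`
  suffices happrox : ∀ ε : ℝ, 0 < ε → ∃ B : H →L[ℂ] H, IsCompactOperator B ∧ ‖B - A‖ ≤ ε by
    have hmem : A ∈ closure {T : H →L[ℂ] H | IsCompactOperator T} := by
      refine Metric.mem_closure_iff.2 fun ε hε => ?_
      obtain ⟨B, hB, hBA⟩ := happrox (ε / 2) (by positivity)
      exact ⟨B, hB, by rw [dist_comm, dist_eq_norm]; linarith⟩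
    rwa [isClosed_setOf_isCompactOperator.closure_eq] at hmem
  intro ε hε
  -- constants
  set M : ℝ := μ.real univ with hM_def
  have hM0 : 0 ≤ M := measureReal_nonneg
  set ε₁ : ℝ := ε / 2 with hε₁_def
  have hε₁ : 0 < ε₁ := by positivity
  set δ : ℝ := ε / (2 * (‖A‖ * M + 1)) with hδ_def
  have hden : 0 < ‖A‖ * M + 1 := by positivity
  have hδ : 0 < δ := by positivity
  -- Step 1: left uniform `L¹`-continuity of `f`
  obtain ⟨V, hV, hVε⟩ := exists_nhds_one_forall_integral_norm_leftTranslate_sub_le η f hε₁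
  -- Step 2: pull back to `K`, shrink to an open neighbourhood `U` of `1`
  have hVK : ιK ⁻¹' V ∈ 𝓝 (1 : K) := hι.continuousAt.preimage_mem_nhds (by rwa [map_one])
  obtain ⟨U, hUV, hUo, hU1⟩ := mem_nhds_iff.1 hVK
  -- Step 3: a normalised Urysohn bump `ψ₀` supported in `U`
  obtain ⟨u, hu0, hu1, hu01⟩ := exists_continuous_zero_one_of_isClosed hUo.isClosed_compl isClosed_singleton
    (disjoint_singleton_right.2 fun h => h hU1)
  have hu_nonneg : ∀ k, 0 ≤ u k := fun k => (hu01 k).1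
  have hu_one : u 1 = 1 := hu1 rfl
  set c : ℝ := ∫ k, u k ∂μ with hc_def
  have hc0 : 0 < c :=
    u.continuous.integral_pos_of_hasCompactSupport_nonneg_nonzero (HasCompactSupport.of_compactSpace _) hu_nonneg (by rw [hu_one]; exact one_ne_zero)
  let ψ₀ : C(K, ℂ) := ⟨fun k => ((c⁻¹ * u k : ℝ) : ℂ), Complex.continuous_ofReal.comp (continuous_const.mul u.continuous)⟩
  have hψ₀_apply : ∀ k, ψ₀ k = ((c⁻¹ * u k : ℝ) : ℂ) := fun k => rfl
  have hψ₀_norm : ∀ k, ‖ψ₀ k‖ = c⁻¹ * u k := fun k => by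
    rw [hψ₀_apply, Complex.norm_real, Real.norm_of_nonneg (mul_nonneg (inv_nonneg.2 hc0.le) (hu_nonneg k))]
  have hψ₀_int : ∫ k, ψ₀ k ∂μ = 1 := by
    simp only [hψ₀_apply]
    rw [integral_complex_ofReal, integral_const_mul, ← hc_def, inv_mul_cancel₀ hc0.ne']
    norm_num
  have hψ₀_norm_int : ∫ k, ‖ψ₀ k‖ ∂μ = 1 := by
    simp only [hψ₀_norm]
    rw [integral_const_mul, ← hc_def, inv_mul_cancel₀ hc0.ne']
  have hψ₀_zero : ∀ k, k ∉ U → ψ₀ k = 0 := fun k hk => by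
    rw [hψ₀_apply, show u k = 0 from hu0 hk, mul_zero, Complex.ofReal_zero]
  -- Step 3': `‖σ(ψ₀)(A v) − A v‖ ≤ ε₁ ‖v‖`
  have hbump : ∀ v : H, ‖smear σ μ ψ₀ (A v) - A v‖ ≤ ε₁ * ‖v‖ := by
    intro v
    set w : H := A v with hw_def
    have hint : Integrable (fun k : K => ψ₀ k • σ k w) μ := integrable_smul_orbit hσc ψ₀ w
    have hint' : Integrable (fun k : K => ψ₀ k • w) μ := (ψ₀.continuous.smul continuous_const).integrable_of_hasCompactSupport (HasCompactSupport.of_compactSpace _)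
    have h1 : smear σ μ ψ₀ w - w = ∫ k, ψ₀ k • (σ k w - w) ∂μ := by
      have h2 : (∫ k, ψ₀ k • w ∂μ) = w := by rw [integral_smul_const, hψ₀_int, one_smul]
      rw [smear_def, show (∫ k, ψ₀ k • σ k w ∂μ) - w = (∫ k, ψ₀ k • σ k w ∂μ) - ∫ k, ψ₀ k • w ∂μ by rw [h2],
        ← integral_sub hint hint']
      exact integral_congr_ae (Eventually.of_forall fun k => (smul_sub (ψ₀ k) (σ k w) w).symm)
    -- pointwise bound
    have hpt : ∀ k, ‖ψ₀ k • (σ k w - w)‖ ≤ ‖ψ₀ k‖ * (ε₁ * ‖v‖) := by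
      intro k
      rw [norm_smul]
      by_cases hk : k ∈ U
      · refine mul_le_mul_of_nonneg_left ?_ (norm_nonneg _)
        have hg : ιK k ∈ V := hUV hk
        calc ‖σ k w - w‖ = ‖π (ιK k) (A v) - A v‖ := rfl
          _ ≤ (∫ x, ‖f ((ιK k)⁻¹ * x) - f x‖ ∂η) * ‖v‖ := norm_apply_integratedOperator_sub_le hu hc η f (ιK k) v
          _ ≤ ε₁ * ‖v‖ := mul_le_mul_of_nonneg_right (hVε _ hg) (norm_nonneg _)
      · rw [hψ₀_zero k hk, norm_zero, zero_mul, zero_mul]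
    rw [h1]
    calc ‖∫ k, ψ₀ k • (σ k w - w) ∂μ‖ ≤ ∫ k, ‖ψ₀ k‖ * (ε₁ * ‖v‖) ∂μ :=
          norm_integral_le_of_norm_le ((ψ₀.continuous.norm.mul continuous_const).integrable_of_hasCompactSupport (HasCompactSupport.of_compactSpace _))
            (Eventually.of_forall hpt)
      _ = ε₁ * ‖v‖ := by rw [integral_mul_const, hψ₀_norm_int, one_mul]
  -- Step 4: Peter–Weyl — a `K`-finite `ψ` uniformly `δ`-close to `ψ₀`
  obtain ⟨ψ, hψ, hdist⟩ := (dense_translationFiniteSubalgebra (G := K)).exists_dist_lt ψ₀ hδ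
  have hψtf : IsTranslationFinite ψ := hψ
  -- Step 5: the compact candidate `σ(ψ) ∘ A`
  set B : H →L[ℂ] H := σ.integratedOperator hσu hσc μ ⟨ψ, HasCompactSupport.of_compactSpace ψ⟩ with hB_def
  have hBcpt : IsCompactOperator B := isCompactOperator_integratedOperator_of_isTranslationFinite (μ := μ) hσu hσc hadm hψtf
  refine ⟨B ∘L A, hBcpt.comp_clm A, ?_⟩
  -- Step 6: `‖σ(ψ) A − A‖ ≤ ε`
  refine ContinuousLinearMap.opNorm_le_bound _ hε.le fun v => ?_
  have hBA : (B ∘L A - A) v = (smear σ μ ψ (A v) - smear σ μ ψ₀ (A v)) + (smear σ μ ψ₀ (A v) - A v) := by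
    change B (A v) - A v = _
    rw [hB_def, ← smear_eq_integratedOperator hσu hσc μ ψ (A v)]
    abel
  have hdiff : ‖smear σ μ ψ (A v) - smear σ μ ψ₀ (A v)‖ ≤ ‖A‖ * M * δ * ‖v‖ := by
    have hsub : smear σ μ (ψ - ψ₀) (A v) = smear σ μ ψ (A v) - smear σ μ ψ₀ (A v) := (smearₗ σ μ hσc (A v)).map_sub ψ ψ₀
    rw [← hsub]
    have h1 := norm_smear_le (π := σ) (μ := μ) (A v) (C := ‖A v‖) (fun k => (hσu.norm_map k (A v)).le) (ψ - ψ₀)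
    have h2 : ‖ψ - ψ₀‖ ≤ δ := by rw [← dist_eq_norm, dist_comm]; exact hdist.le
    calc ‖smear σ μ (ψ - ψ₀) (A v)‖ ≤ ‖A v‖ * μ.real univ * ‖ψ - ψ₀‖ := h1
      _ ≤ (‖A‖ * ‖v‖) * M * δ := by
          rw [← hM_def]
          exact mul_le_mul (mul_le_mul_of_nonneg_right (A.le_opNorm v) hM0) h2 (norm_nonneg _) (by positivity)
      _ = ‖A‖ * M * δ * ‖v‖ := by ring
  have hkey : ‖A‖ * M * δ ≤ ε / 2 := by
    rw [hδ_def]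
    have : ‖A‖ * M * (ε / (2 * (‖A‖ * M + 1))) = (ε / 2) * (‖A‖ * M / (‖A‖ * M + 1)) := by
      field_simp
    rw [this]
    have hle : ‖A‖ * M / (‖A‖ * M + 1) ≤ 1 := by
      rw [div_le_one hden]
      linarith
    calc ε / 2 * (‖A‖ * M / (‖A‖ * M + 1)) ≤ ε / 2 * 1 := mul_le_mul_of_nonneg_left hle (by positivity)
      _ = ε / 2 := mul_one _
  rw [hBA]
  calc ‖smear σ μ ψ (A v) - smear σ μ ψ₀ (A v) + (smear σ μ ψ₀ (A v) - A v)‖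
      ≤ ‖smear σ μ ψ (A v) - smear σ μ ψ₀ (A v)‖ + ‖smear σ μ ψ₀ (A v) - A v‖ := norm_add_le _ _
    _ ≤ ‖A‖ * M * δ * ‖v‖ + ε₁ * ‖v‖ := add_le_add hdiff (hbump v)
    _ ≤ ε / 2 * ‖v‖ + ε / 2 * ‖v‖ := by
        refine add_le_add (mul_le_mul_of_nonneg_right hkey (norm_nonneg _)) ?_
        rw [hε₁_def]
    _ = ε * ‖v‖ := by ring

end Generic

/-! ## §2 The residual spectrum: ★ `ResidualSpectrumCompact 𝒢 μ 𝔓` from `K`-admissibility of `L²_res` -/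

section Residual

variable {F : Type} [Field F] [NumberField F] (𝒢 : AdelicGroupData.{u} F) (μ : Measure 𝒢.automorphicQuotient) [𝒢.IsAutomorphicMeasure μ]
  (𝔓 : 𝒢.ParabolicUnipotentData) [LocallyCompactSpace 𝒢.Adelic]

/-- **THE ADMISSIBILITY ENTRANCE (generic adelic datum).**  `𝒢` an adelic group datum with `G(𝔸)` locally compact, `μ` automorphic, `𝔓` a family of radicals,
`K` compact Hausdorff with a continuous `ιK : K →* G(𝔸)`.  IF the residual spectrum `L²_res = L²_disc ⊓ (L²_cusp)ᗮ` (★ `residualSubspace`, as the unitary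
representation ★ `ClosedSubrep.toContRep`) is `K`-ADMISSIBLE — every finite-dimensional irreducible `K`-stable `E ≤ L²_res` has finite-dimensional isotypic part
(★ `hadm` currency) — THEN ★ `ResidualSpectrumCompact 𝒢 μ 𝔓`: for the Borel structure, every Haar `η` and every `f ∈ C_c(G(𝔸), ℂ)`, `L²_res ∋ w ↦ R(f)w` is compact
(§1 on `L²_res`, then the inclusion `L²_res ↪ L²`).  In print the hypothesis is Langlands' finiteness for `K = K_∞K_f`.
[cite: MoeglinWaldspurger1995, I.2.18 and V.3.13] [cite: HarishChandra1968, Thm. 1] [cite: BorelWallach2000, 0 §2.3] -/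
theorem residualSpectrumCompact_of_admissible
    {K : Type*} [Group K] [TopologicalSpace K] [IsTopologicalGroup K] [CompactSpace K] [T2Space K] (ιK : K →* 𝒢.Adelic) (hι : Continuous ιK)
    (hadm : ∀ (E : Submodule ℂ (residualSubspace 𝒢 μ 𝔓).toSubmodule)
      (hE : ∀ k, ∀ x ∈ E, ((residualSubspace 𝒢 μ 𝔓).toContRep.restrict ιK) k x ∈ E), FiniteDimensional ℂ E →
      (((residualSubspace 𝒢 μ 𝔓).toContRep.restrict ιK).subRep E hE).IsIrreducible →
      FiniteDimensional ℂ (Representation.homRangeSum ((residualSubspace 𝒢 μ 𝔓).toContRep.restrict ιK).toRepresentation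
        (((residualSubspace 𝒢 μ 𝔓).toContRep.restrict ιK).subRep E hE))) :
    ResidualSpectrumCompact 𝒢 μ 𝔓 := by
  intro _ _ η _ f
  set W := residualSubspace 𝒢 μ 𝔓 with hW_def
  have hWu : W.toContRep.IsUnitary := (𝒢.isUnitary_rightRegular μ).toContRep W
  have hWc : W.toContRep.IsStronglyContinuous := isStronglyContinuous_toContRep_of_isStronglyContinuous (𝒢.isStronglyContinuous_rightRegular_holds μ) W
  have hcpt : IsCompactOperator (W.toContRep.integratedOperator hWu hWc η f) :=
    isCompactOperator_integratedOperator_of_admissible hWu hWc ιK hι hadm η f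
  -- `R(f) w = ι (R|_W(f) w)` for the inclusion `ι : L²_res ↪ L²`
  have hcoe : (fun w : W.toSubmodule =>
      (𝒢.rightRegular μ).integratedOperator (𝒢.isUnitary_rightRegular μ) (𝒢.isStronglyContinuous_rightRegular_holds μ) η f (w : 𝒢.L2 μ)) =
      (W.toSubmodule.subtypeL : W.toSubmodule → 𝒢.L2 μ) ∘ (W.toContRep.integratedOperator hWu hWc η f) := by
    funext w
    change _ = W.toSubmodule.subtypeL (W.toContRep.integratedOperator hWu hWc η f w)
    rw [ContRepresentation.integratedOperator_apply, ContRepresentation.integratedOperator_apply]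
    refine Eq.trans ?_ ((W.toSubmodule.subtypeL).integral_comp_comm (ContRepresentation.integrable_smul_apply hWc η f w))
    exact integral_congr_ae (Eventually.of_forall fun g => rfl)
  rw [hcoe]
  exact hcpt.clm_comp W.toSubmodule.subtypeL

end Residual

/-! ## §3 The `U(Φ_N)` reading: sockets `sig_K2E1ResidualCompactU2` ∕ `sig_K2E1ResidualCompactU3R` ⟸ «`L²_res(U(Φ_N))` is `K`-admissible» -/

section Unitary

open NumberField Literature.NumberTheory.Automorphic.UnitaryGroup

variable (L : Type) [Field L] [NumberField L] [IsCMField L] (N : ℕ)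
  (μ : Measure (cmDatum L N (Matrix.of fun i j : Fin N => if i.val + j.val + 1 = N then (1 : L) else 0)).automorphicQuotient)
  [(cmDatum L N (Matrix.of fun i j : Fin N => if i.val + j.val + 1 = N then (1 : L) else 0)).IsAutomorphicMeasure μ]

/-- **★ `CmResidualSpectrumCompactR L N μ` ⟸ «`L²_res(U(Φ_N))` IS `K`-ADMISSIBLE» (all `N`; sockets 5Res for `N = 2`, 12R3 for `N = 3`).**  For the quasi-split
unitary group `U(Φ_N)` of a CM field (★ `cmDatum`, `U(Φ_N)(𝔸_{L⁺})` locally compact — ★ instance), an automorphic `μ` and the printed radicals ★ `cmParabolicDataR L N`: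
if for some compact Hausdorff group `K` with a continuous `ιK : K →* U(Φ_N)(𝔸_{L⁺})` (print: `K = K_∞ × K_f`, `K_∞ = ∏_{v∣∞} U(p_v)×U(q_v)`, `K_f` compact open)
the residual spectrum ★ `cmResidualSubspaceR L N μ` is `K`-admissible on irreducible `K`-types, then `R(f)|_{L²_res}` is compact for every Haar `η` and every
`f ∈ C_c`.  The hypothesis is the FINITENESS clause of Langlands' rank-one theory («finitely many residual data per `K`-type», each admissible of finite
multiplicity) — the target (FD) of the campaign «RES-RANK-ONE»; NOT «`(L²_res)^{K_f}` finite-dimensional» (false: the lines `ℂ·(χ∘det)` of all `∞`-types).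
[cite: MoeglinWaldspurger1995, I.2.18 and V.3.13] [cite: Rogawski1990, §13.5 pp. 204–206 and §13.9 p. 227] [cite: HarishChandra1968, Thm. 1] -/
theorem cmResidualSpectrumCompactR_of_admissible
    {K : Type*} [Group K] [TopologicalSpace K] [IsTopologicalGroup K] [CompactSpace K] [T2Space K]
    (ιK : K →* (cmDatum L N (Matrix.of fun i j : Fin N => if i.val + j.val + 1 = N then (1 : L) else 0)).Adelic) (hι : Continuous ιK)
    (hadm : ∀ (E : Submodule ℂ (cmResidualSubspaceR L N μ).toSubmodule)
      (hE : ∀ k, ∀ x ∈ E, ((cmResidualSubspaceR L N μ).toContRep.restrict ιK) k x ∈ E), FiniteDimensional ℂ E →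
      (((cmResidualSubspaceR L N μ).toContRep.restrict ιK).subRep E hE).IsIrreducible →
      FiniteDimensional ℂ (Representation.homRangeSum ((cmResidualSubspaceR L N μ).toContRep.restrict ιK).toRepresentation
        (((cmResidualSubspaceR L N μ).toContRep.restrict ιK).subRep E hE))) :
    CmResidualSpectrumCompactR L N μ :=
  residualSpectrumCompact_of_admissible _ μ (cmParabolicDataR L N) ιK hι hadm

end Unitary

end Summit.HodgeConjecture.HodgeConjecture.Cruxes.H413.K2E1ResidualCompactOfAdmissible

end
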